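import Summits.QuantumFields.YangMills.Theorems.LuscherReductionTwistedTraceScalingMehlerScaling
import Mathlib.Analysis.SpecialFunctions.Gaussian.GaussianIntegral
import Mathlib.MeasureTheory.Group.Integral
import HarnessLib

/-!
# R67 — QUASIMODE PROFILE RIGIDITY: the pointwise sub-harmonic bound `hup` (`∫ M(x,·)Θ ≤ (1+η)·Λ·Θ(x)W(x)` for EVERY `η > 0`, eventually in `β`)
# tolerates NO relative error in the Gaussian exponent of the frozen profile `W` — one-mode Mehler model, exact formulas
# (crux `LuscherReduction.TwistedTraceScaling`, stmt-QuantumFields-20203; bears on lane A's (B-ST) spec `spec_S3` (input `hS3` of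
# ✓`…BOStiffHST.hST_record_of_specs` / ✓`…BOStiffCore.hcore_record_of_specs`) and on the planned (B4b) `…BOStiffCentralUpper`)

Standing-disprover cycle 55.  HONEST FRAMING: a tightness lemma about a stub of a child of the CONDITIONAL reduction route R2b1 — not a gap
in anything landed, not Clay.  Lane A's (B-ST) line feeds C4-CORE through `spec_S3 = ∃M₀ ∀M ≥ M₀ ∀η>0 ∀η₂>0 ∀ᶠβ, hup(η) ∧ hdef(η₂)`, whose
`hup` is a POINTWISE quasimode inequality on the whole support ball `cS` (radius `r(β) = min(1/40, β^{-1/2}·btLog β)`, i.e. `ℓ = btLog β → ∞`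
kernel steps `β^{-1/2}`) for the profile `cΘ = 𝟙·e^{−β²‖P_Γ·‖²}·e^{−stiffGaussExp L (β/2) β}` (✓`cΩ`, ✓`frozenProfile`: floored, not tapered),
the weight `cW = N/χ` and the profile's own Rayleigh quotient `cΛ` as currency.

The one-mode caricature of the based central kernel is the Mehler kernel `k(x,y) = e^{−a x²}·e^{−b (x−y)²}·e^{−a y²}` (`a = (β/2)·h` the magnetic
stiffness of the mode, `b = β` the kinetic coupling) acting on a Gaussian profile `f_c(y) = e^{−c y²}`.  Everything below is exact calculus:
* §1 ★ `mehler_gaussian_action` — `(K f_c)(x) = √(π/(a+b+c)) · e^{−(a + b − b²/(a+b+c))·x²}`; ratio form ★ `mehler_gaussian_action_ratio` —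
  `(K f_c)(x) = √(π/(a+b+c)) · e^{κ·x²} · f_c(x)` with the EXPONENT GAP `κ = (c² − a² − 2ab)/(a+b+c)`; ★ `mehler_gaussian_exact` — `κ = 0` iff
  `c = c_* := √(a² + 2ab)`, the exact ground state (per mode this is lane A's ✓`Stiff.stiff_groundState`; `stiffGaussExp` uses exactly `c_*`).
* §2 ★★ `quasimode_fails_of_stiff` — TOO STIFF (`c² > a² + 2ab`, `κ > 0`): for EVERY constant `Λ` there is a point with `Λ·f_c(x) < (K f_c)(x)`;
  no currency whatsoever rescues a pointwise bound for an over-stiff profile.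
* §3 ★★ `quasimode_fails_of_stiff_truncated` — the same on the TRUNCATED profile `𝟙{|y| ≤ R}·f_c` (the shape of `cΘ·cW`: floored, not tapered):
  the violation sits AT THE EDGE `x = R` of every large enough support ball (`truncated_action_edge_lower`: truncation costs at most the factor
  `1 − √2·e^{−(a+c)²R²/(2(a+b+c))}` at the edge, by the Gaussian tail bound `gaussian_tail_one`).
* §4 ★★ `selfRayleigh_fails_of_soft` — TOO SOFT (`0 < c`, `c² < a² + 2ab`, `κ < 0`): `(K f_c)/f_c = C·e^{κx²}` peaks at the centre, and against
  its OWN Rayleigh quotient `⟨f,Kf⟩/⟨f,f⟩ = C·√(2c/(2c − κ))` the bound `(Kf)(0) ≤ (1+η)·RQ·f(0)` fails for every `η` with `(1+η)²·2c < 2c − κ`.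
* §5 ★ `mehlerRatio_eq_inv_denominator` — consistency anchor with the tree: lane A's β-free Mehler ratio is `r(h) = 1/(a + b + c_*)` at the scaled
  datum `(a,b) = (h/2, 1)`, i.e. the top eigenvalue `√(π/(a+b+c_*))` of §1 in the units of ✓`Mehler.mehlerRatio`.

READING FOR THE LEAD / w1 (why this is the guard-rail of (A) and (B4b)).  (i) The profile exponent is RIGID: within the Gaussian class `hup ∀η`
(eventually) is met by `c = c_*` and by nothing else.  Lattice datum per normal mode: `a = (β/2)h`, `b = β`, `c_* = β√(h²/4 + h)`; a RELATIVE exponent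
error `θ` in one stiff mode (`c = (1+θ)c_*` — e.g. a kinetic factor `e^{−β(1+θ)‖·‖²}`, a slipped magnetic normalisation `t = β` vs `β/2`, or the chart
metric `‖dw‖²` used for `‖dx̂‖²` uncorrected) gives `κ ≍ θβ` and the violation factor `e^{κR²} = e^{Θ(θℓ²)} → ∞` AT THE EDGE `R = β^{-1/2}ℓ` of `cS`
for every FIXED `θ > 0` (§2–§3); a too-SOFT mode fails at the centre by the fixed factor `√((2c−κ)/(2c)) > 1` against the self-Rayleigh currency (§4).
So the comparison of `cM` with the harmonic kernel in (A)/(B4b) must control `β·|S(oT1 x) − ⟨x̂, Hx̂⟩|` in ABSOLUTE sup-norm `o(1)` on the whole of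
`cS` (available: `2000|P|·βr³ = 2000|P|·β^{-1/2}ℓ³ → 0` from ✓`abs_wilsonAction_gnomonic_sub_curl_le`, plus the `O(βr⁴) = O(β^{-1}ℓ⁴)` chart term);
a bound of the shape `(1 ± θ)·β·(…)` with fixed `θ` is NOT enough.  (ii) With the right exponent the ratio `(Kf)/f` is the constant
`√(π/(a+b+c_*))` (§1), so `hup`/`hdef` hold with `η, η₂ → 0` against the self-Rayleigh currency up to the truncation layer.  (iii) Truncation only
LOWERS `K(Θf)`, so it never hurts `hup`; its cost for `hdef` is the edge layer: in a stiff mode (`a + c > 0`) the edge keeps all but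
`√2·e^{−(a+c)²R²/(2(a+b+c))}` (§3: the ground chain contracts, `m = bR/(a+b+c) < R`), in a flat mode (`a = c = 0`: the harmonic 1-forms) a factor
`≤ 2` is lost on a boundary layer of relative `cΘ²cW`-mass `O(dim/ℓ)` — both `o(1)` as `ℓ → ∞` (the mechanism behind w3's `MehlerExit`/`BoxBallExit`);
truncation does NOT cure an exponent error, whose violation sits at the same edge (§3).
VERDICT 55: no kill — the lead's `stiffGaussExp L (β/2) β` has per-mode coefficient `√(aᵢ² + 2aᵢβ)`, `aᵢ` the eigenvalues of `(β/2)H`, which IS `c_*`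
(rigidity met by design); this file records what any deviation would cost.  [folklore] (Mehler kernel / harmonic transfer matrix:
[cite: Wipf2021, §8.5.1 (8.56)–(8.58)] [cite: Wipf2021, §8.5.2 (8.64)–(8.67)]).
-/

set_option autoImplicit false

noncomputable section

open Real MeasureTheory Set

namespace Summit.QuantumFields.YangMills.Theorems.TwistedTraceScaling.Negative.R67

/-! ## §1 The one-mode Mehler kernel acting on a Gaussian profile — exact formulas -/

/-- Shifted Gaussian integral `∫ e^{−α(y−m)²} dy = √(π/α)` (for `α ≤ 0` both sides vanish, as in `integral_gaussian`). [folklore] -/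
theorem integral_gaussian_shift (α m : ℝ) : ∫ y, Real.exp (-(α * (y - m) ^ 2)) = Real.sqrt (π / α) := by
  have h := integral_sub_right_eq_self (μ := (volume : Measure ℝ)) (fun y : ℝ => Real.exp (-(α * y ^ 2))) m
  rw [h]
  have h2 := integral_gaussian α
  simp_rw [neg_mul] at h2
  exact h2

/-- Completing the square in the Mehler exponent. [folklore] -/
theorem mehler_exponent_eq {a b c : ℝ} (hα : a + b + c ≠ 0) (x y : ℝ) :
    -(a * x ^ 2) + -(b * (x - y) ^ 2) + -(a * y ^ 2) + -(c * y ^ 2) =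
      -((a + b - b ^ 2 / (a + b + c)) * x ^ 2) + -((a + b + c) * (y - b * x / (a + b + c)) ^ 2) := by
  field_simp
  ring

/-- ★ `(K f_c)(x) = √(π/(a+b+c)) · e^{−(a + b − b²/(a+b+c))·x²}` for the Mehler kernel `k(x,y) = e^{−ax²}e^{−b(x−y)²}e^{−ay²}` and the profile
`f_c(y) = e^{−cy²}` (`a + b + c > 0`). [folklore] [cite: Wipf2021, §8.5.1 (8.56)–(8.58)] -/
theorem mehler_gaussian_action {a b c : ℝ} (hα : 0 < a + b + c) (x : ℝ) :
    ∫ y, Real.exp (-(a * x ^ 2)) * Real.exp (-(b * (x - y) ^ 2)) * Real.exp (-(a * y ^ 2)) * Real.exp (-(c * y ^ 2)) =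
      Real.sqrt (π / (a + b + c)) * Real.exp (-((a + b - b ^ 2 / (a + b + c)) * x ^ 2)) := by
  have hpt : ∀ y : ℝ, Real.exp (-(a * x ^ 2)) * Real.exp (-(b * (x - y) ^ 2)) * Real.exp (-(a * y ^ 2)) * Real.exp (-(c * y ^ 2)) =
      Real.exp (-((a + b - b ^ 2 / (a + b + c)) * x ^ 2)) * Real.exp (-((a + b + c) * (y - b * x / (a + b + c)) ^ 2)) := by
    intro y
    rw [← Real.exp_add, ← Real.exp_add, ← Real.exp_add, ← Real.exp_add, mehler_exponent_eq hα.ne' x y]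
  simp_rw [hpt]
  rw [integral_const_mul, integral_gaussian_shift, mul_comm]

/-- ★ Ratio form: `(K f_c)(x) = √(π/(a+b+c)) · e^{κx²} · f_c(x)`, EXPONENT GAP `κ = (c² − a² − 2ab)/(a+b+c)`. [folklore] -/
theorem mehler_gaussian_action_ratio {a b c : ℝ} (hα : 0 < a + b + c) (x : ℝ) :
    ∫ y, Real.exp (-(a * x ^ 2)) * Real.exp (-(b * (x - y) ^ 2)) * Real.exp (-(a * y ^ 2)) * Real.exp (-(c * y ^ 2)) =
      Real.sqrt (π / (a + b + c)) * Real.exp ((c ^ 2 - a ^ 2 - 2 * a * b) / (a + b + c) * x ^ 2) * Real.exp (-(c * x ^ 2)) := by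
  rw [mehler_gaussian_action hα, mul_assoc, ← Real.exp_add]
  congr 2
  field_simp
  ring

/-- ★ The exact ground state: for `c² = a² + 2ab` (`κ = 0`) the profile is reproduced with the factor `√(π/(a+b+c))` — per normal mode this is
lane A's ✓`Stiff.stiff_groundState`, and `stiffGaussExp L t b` uses exactly these coefficients `cᵢ = √(aᵢ² + 2aᵢb)`. [cite: Wipf2021, §8.5.2 (8.64)–(8.67)] -/
theorem mehler_gaussian_exact {a b c : ℝ} (hα : 0 < a + b + c) (hc : c ^ 2 = a ^ 2 + 2 * a * b) (x : ℝ) :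
    ∫ y, Real.exp (-(a * x ^ 2)) * Real.exp (-(b * (x - y) ^ 2)) * Real.exp (-(a * y ^ 2)) * Real.exp (-(c * y ^ 2)) =
      Real.sqrt (π / (a + b + c)) * Real.exp (-(c * x ^ 2)) := by
  rw [mehler_gaussian_action_ratio hα, show c ^ 2 - a ^ 2 - 2 * a * b = 0 by rw [hc]; ring]
  simp

/-! ## §2 TOO STIFF: no constant rescues the pointwise bound -/

/-- ★★ **Over-stiff profiles are not quasimodes for ANY currency.**  If `c² > a² + 2ab` then for every `Λ` there is a point `x` with
`Λ·f_c(x) < (K f_c)(x)`: the ratio `(Kf_c)/f_c = √(π/(a+b+c))·e^{κx²}`, `κ > 0`, is unbounded. [folklore] -/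
theorem quasimode_fails_of_stiff {a b c : ℝ} (hα : 0 < a + b + c) (hc : a ^ 2 + 2 * a * b < c ^ 2) (Λ : ℝ) :
    ∃ x : ℝ, Λ * Real.exp (-(c * x ^ 2)) <
      ∫ y, Real.exp (-(a * x ^ 2)) * Real.exp (-(b * (x - y) ^ 2)) * Real.exp (-(a * y ^ 2)) * Real.exp (-(c * y ^ 2)) := by
  set C := Real.sqrt (π / (a + b + c)) with hC
  have hC0 : 0 < C := Real.sqrt_pos.2 (div_pos Real.pi_pos hα)
  set κ := (c ^ 2 - a ^ 2 - 2 * a * b) / (a + b + c) with hκ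
  have hκ0 : 0 < κ := div_pos (by linarith) hα
  set T := (|Λ| / C + 1) / κ with hT
  have hT0 : 0 ≤ T := by positivity
  refine ⟨Real.sqrt T, ?_⟩
  rw [mehler_gaussian_action_ratio hα, Real.sq_sqrt hT0]
  have h1 : 1 + κ * T ≤ Real.exp (κ * T) := by linarith [Real.add_one_le_exp (κ * T)]
  have h2 : κ * T = |Λ| / C + 1 := by rw [hT]; field_simp
  have h3 : Λ < C * Real.exp (κ * T) := by
    have h4 : C * (1 + κ * T) ≤ C * Real.exp (κ * T) := mul_le_mul_of_nonneg_left h1 hC0.le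
    have h5 : C * (1 + κ * T) = 2 * C + |Λ| := by rw [h2]; field_simp; ring
    linarith [le_abs_self Λ]
  calc Λ * Real.exp (-(c * T)) < C * Real.exp (κ * T) * Real.exp (-(c * T)) := mul_lt_mul_of_pos_right h3 (Real.exp_pos _)
    _ = _ := by ring

/-! ## §3 TOO STIFF on a TRUNCATED profile: the violation sits at the edge of the support ball -/

/-- One-dimensional Gaussian tail: `∫ 𝟙{δ ≤ |y − m|}·e^{−α(y−m)²} ≤ e^{−αδ²/2}·√(π/(α/2))` (`α > 0`, `δ ≥ 0`; half the exponent pays for the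
cut, cf. ✓`BT.gaussian_tail_le`). [folklore] -/
theorem gaussian_tail_one {α : ℝ} (hα : 0 < α) (m : ℝ) {δ : ℝ} (hδ : 0 ≤ δ) :
    ∫ y, ({y : ℝ | δ ≤ |y - m|}).indicator (fun y => Real.exp (-(α * (y - m) ^ 2))) y ≤
      Real.exp (-(α * δ ^ 2 / 2)) * Real.sqrt (π / (α / 2)) := by
  have hpt : ∀ y, ({y : ℝ | δ ≤ |y - m|}).indicator (fun y => Real.exp (-(α * (y - m) ^ 2))) y ≤
      Real.exp (-(α * δ ^ 2 / 2)) * Real.exp (-(α / 2 * (y - m) ^ 2)) := by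
    intro y
    by_cases hy : y ∈ {y : ℝ | δ ≤ |y - m|}
    · rw [Set.indicator_of_mem hy, ← Real.exp_add]
      refine Real.exp_le_exp.2 ?_
      have hy' : δ ≤ |y - m| := hy
      have h2 : δ ^ 2 ≤ (y - m) ^ 2 := by rw [← sq_abs (y - m)]; exact pow_le_pow_left₀ hδ hy' 2
      nlinarith
    · rw [Set.indicator_of_notMem hy]; positivity
  have h0 : ∀ y, 0 ≤ ({y : ℝ | δ ≤ |y - m|}).indicator (fun y => Real.exp (-(α * (y - m) ^ 2))) y :=
    fun y => Set.indicator_nonneg (fun _ _ => (Real.exp_pos _).le) y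
  have hint : Integrable (fun y : ℝ => Real.exp (-(α / 2 * (y - m) ^ 2))) := by
    have h := (integrable_exp_neg_mul_sq (half_pos hα)).comp_sub_right m
    simpa [neg_mul] using h
  calc ∫ y, ({y : ℝ | δ ≤ |y - m|}).indicator (fun y => Real.exp (-(α * (y - m) ^ 2))) y
      ≤ ∫ y, Real.exp (-(α * δ ^ 2 / 2)) * Real.exp (-(α / 2 * (y - m) ^ 2)) :=
        integral_mono_of_nonneg (ae_of_all _ h0) (hint.const_mul _) (ae_of_all _ hpt)
    _ = Real.exp (-(α * δ ^ 2 / 2)) * Real.sqrt (π / (α / 2)) := by rw [integral_const_mul, integral_gaussian_shift]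

/-- ★ **Edge lower bound for the truncated profile.**  For `0 ≤ a`, `0 < b`, `0 < c`, `0 ≤ R` the Mehler kernel applied to `𝟙{|y| ≤ R}·f_c`,
evaluated AT THE EDGE `x = R`, retains at least the fraction `1 − √2·e^{−(a+c)²R²/(2(a+b+c))}` of the untruncated value: the ground chain started at `R`
lands near `m = bR/(a+b+c) < R`, well inside the ball. [folklore] -/
theorem truncated_action_edge_lower {a b c : ℝ} (ha : 0 ≤ a) (hb : 0 < b) (hc : 0 < c) {R : ℝ} (hR : 0 ≤ R) :
    (1 - Real.sqrt 2 * Real.exp (-((a + c) ^ 2 * R ^ 2 / (2 * (a + b + c))))) *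
        (Real.sqrt (π / (a + b + c)) * Real.exp (-((a + b - b ^ 2 / (a + b + c)) * R ^ 2))) ≤
      ∫ y, Real.exp (-(a * R ^ 2)) * Real.exp (-(b * (R - y) ^ 2)) * Real.exp (-(a * y ^ 2)) *
        (({y : ℝ | |y| ≤ R}).indicator (fun y => Real.exp (-(c * y ^ 2))) y) := by
  have hα : 0 < a + b + c := by linarith
  set α := a + b + c with hαdef
  set m := b * R / α with hm
  set δ := (a + c) * R / α with hδ
  set E := Real.exp (-((a + b - b ^ 2 / α) * R ^ 2)) with hE
  have hm0 : 0 ≤ m := by positivity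
  have hδ0 : 0 ≤ δ := by positivity
  have hmδ : m + δ = R := by rw [hm, hδ]; field_simp; ring
  -- the Gaussian `g(y) = E · e^{−α(y−m)²}` is the untruncated integrand at `x = R`
  set g : ℝ → ℝ := fun y => E * Real.exp (-(α * (y - m) ^ 2)) with hg
  have hg0 : ∀ y, 0 ≤ g y := fun y => by positivity
  have hgint : Integrable g := by
    have h := (integrable_exp_neg_mul_sq hα).comp_sub_right m
    simpa [neg_mul, hg] using h.const_mul E
  have hfull : ∀ y, Real.exp (-(a * R ^ 2)) * Real.exp (-(b * (R - y) ^ 2)) * Real.exp (-(a * y ^ 2)) * Real.exp (-(c * y ^ 2)) = g y := by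
    intro y
    simp only [hg, hE]
    rw [← Real.exp_add, ← Real.exp_add, ← Real.exp_add, ← Real.exp_add, mehler_exponent_eq hα.ne' R y]
  -- pointwise: truncated integrand ≥ g − 𝟙{δ ≤ |y−m|}·g (the interval `|y − m| < δ` lies inside `|y| ≤ R`)
  have hpt : ∀ y, g y - ({y : ℝ | δ ≤ |y - m|}).indicator g y ≤
      Real.exp (-(a * R ^ 2)) * Real.exp (-(b * (R - y) ^ 2)) * Real.exp (-(a * y ^ 2)) *
        (({y : ℝ | |y| ≤ R}).indicator (fun y => Real.exp (-(c * y ^ 2))) y) := by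
    intro y
    by_cases hy : y ∈ {y : ℝ | δ ≤ |y - m|}
    · rw [Set.indicator_of_mem hy, sub_self]
      exact mul_nonneg (by positivity) (Set.indicator_nonneg (fun _ _ => (Real.exp_pos _).le) y)
    · have hy' : |y - m| < δ := not_le.1 hy
      have hyR : y ∈ {y : ℝ | |y| ≤ R} := by
        show |y| ≤ R
        rw [abs_lt] at hy'
        rw [abs_le]; constructor <;> linarith
      rw [Set.indicator_of_notMem hy, sub_zero, Set.indicator_of_mem hyR, hfull]
  have htail : ∫ y, ({y : ℝ | δ ≤ |y - m|}).indicator g y ≤ E * (Real.exp (-(α * δ ^ 2 / 2)) * Real.sqrt (π / (α / 2))) := by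
    have h1 : ∀ y, ({y : ℝ | δ ≤ |y - m|}).indicator g y =
        E * ({y : ℝ | δ ≤ |y - m|}).indicator (fun y => Real.exp (-(α * (y - m) ^ 2))) y := by
      intro y
      by_cases hy : y ∈ {y : ℝ | δ ≤ |y - m|}
      · rw [Set.indicator_of_mem hy, Set.indicator_of_mem hy]
      · rw [Set.indicator_of_notMem hy, Set.indicator_of_notMem hy, mul_zero]
    simp_rw [h1]
    rw [integral_const_mul]
    exact mul_le_mul_of_nonneg_left (gaussian_tail_one hα m hδ0) (by positivity)
  have hmeas : MeasurableSet {y : ℝ | δ ≤ |y - m|} :=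
    measurableSet_le measurable_const ((measurable_id.sub measurable_const).abs)
  have hind_int : Integrable (fun y => ({y : ℝ | δ ≤ |y - m|}).indicator g y) := hgint.indicator hmeas
  have hsq : Real.sqrt (π / (α / 2)) = Real.sqrt 2 * Real.sqrt (π / α) := by
    rw [← Real.sqrt_mul (by norm_num : (0:ℝ) ≤ 2)]
    congr 1
    field_simp
  have hexp : Real.exp (-(α * δ ^ 2 / 2)) = Real.exp (-((a + c) ^ 2 * R ^ 2 / (2 * α))) := by
    congr 1
    rw [hδ]
    field_simp
  calc (1 - Real.sqrt 2 * Real.exp (-((a + c) ^ 2 * R ^ 2 / (2 * α)))) * (Real.sqrt (π / α) * E)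
      = E * Real.sqrt (π / α) - E * (Real.exp (-(α * δ ^ 2 / 2)) * Real.sqrt (π / (α / 2))) := by rw [hsq, hexp]; ring
    _ ≤ (∫ y, g y) - ∫ y, ({y : ℝ | δ ≤ |y - m|}).indicator g y := by
        have hI : ∫ y, g y = E * Real.sqrt (π / α) := by simp only [hg]; rw [integral_const_mul, integral_gaussian_shift]
        rw [hI]
        linarith [htail]
    _ = ∫ y, (g y - ({y : ℝ | δ ≤ |y - m|}).indicator g y) := (integral_sub hgint hind_int).symm
    _ ≤ _ := by
        refine integral_mono_of_nonneg (ae_of_all _ fun y => ?_) ?_ (ae_of_all _ hpt)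
        · show 0 ≤ g y - ({y : ℝ | δ ≤ |y - m|}).indicator g y
          by_cases hy : y ∈ {y : ℝ | δ ≤ |y - m|}
          · rw [Set.indicator_of_mem hy, sub_self]
          · rw [Set.indicator_of_notMem hy, sub_zero]; exact hg0 y
        · -- integrability of the truncated integrand: dominated by `g`
          have hmeasR : MeasurableSet {y : ℝ | |y| ≤ R} := measurableSet_le measurable_id.abs measurable_const
          have heq : (fun y => Real.exp (-(a * R ^ 2)) * Real.exp (-(b * (R - y) ^ 2)) * Real.exp (-(a * y ^ 2)) *
              (({y : ℝ | |y| ≤ R}).indicator (fun y => Real.exp (-(c * y ^ 2))) y)) = fun y => ({y : ℝ | |y| ≤ R}).indicator g y := by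
            funext y
            by_cases hy : y ∈ {y : ℝ | |y| ≤ R}
            · rw [Set.indicator_of_mem hy, Set.indicator_of_mem hy, hfull]
            · rw [Set.indicator_of_notMem hy, Set.indicator_of_notMem hy, mul_zero]
          rw [heq]
          exact hgint.indicator hmeasR

/-- ★★ **Over-stiff truncated profiles fail `hup` AT THE EDGE of every large support ball.**  For `0 ≤ a`, `0 < b`, `0 < c` with
`c² > a² + 2ab` and every `Λ` there is `R₀` such that for all `R ≥ R₀` the truncated profile `Θf := 𝟙{|y| ≤ R}·f_c` violates
`(K Θf)(x) ≤ Λ·Θf(x)` at the boundary point `x = R` of its own support. [folklore] -/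
theorem quasimode_fails_of_stiff_truncated {a b c : ℝ} (ha : 0 ≤ a) (hb : 0 < b) (hc : 0 < c) (hstiff : a ^ 2 + 2 * a * b < c ^ 2) (Λ : ℝ) :
    ∃ R₀ : ℝ, ∀ R : ℝ, R₀ ≤ R →
      Λ * (({y : ℝ | |y| ≤ R}).indicator (fun y => Real.exp (-(c * y ^ 2))) R) <
        ∫ y, Real.exp (-(a * R ^ 2)) * Real.exp (-(b * (R - y) ^ 2)) * Real.exp (-(a * y ^ 2)) *
          (({y : ℝ | |y| ≤ R}).indicator (fun y => Real.exp (-(c * y ^ 2))) y) := by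
  have hα : 0 < a + b + c := by linarith
  set α := a + b + c with hαdef
  set C := Real.sqrt (π / α) with hC
  have hC0 : 0 < C := Real.sqrt_pos.2 (div_pos Real.pi_pos hα)
  set κ := (c ^ 2 - a ^ 2 - 2 * a * b) / α with hκ
  have hκ0 : 0 < κ := div_pos (by linarith) hα
  have hac : 0 < a + c := by linarith
  -- R₀² covers both requirements: the edge loss ≤ 1/2 and ½·C·e^{κR²} > Λ
  set T := 4 * α / (a + c) ^ 2 + (2 * |Λ| / C + 1) / κ with hT
  have hT0 : 0 ≤ T := by positivity
  refine ⟨Real.sqrt T, fun R hR => ?_⟩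
  have hR0 : 0 ≤ R := (Real.sqrt_nonneg T).trans hR
  have hR2 : T ≤ R ^ 2 := by
    calc T = Real.sqrt T ^ 2 := (Real.sq_sqrt hT0).symm
      _ ≤ R ^ 2 := pow_le_pow_left₀ (Real.sqrt_nonneg T) hR 2
  have hT1 : 4 * α / (a + c) ^ 2 ≤ R ^ 2 := le_trans (by rw [hT]; linarith [div_nonneg (by positivity : 0 ≤ 2 * |Λ| / C + 1) hκ0.le]) hR2
  have hT2 : (2 * |Λ| / C + 1) / κ ≤ R ^ 2 := le_trans (by rw [hT]; linarith [div_nonneg (by positivity : 0 ≤ 4 * α) (sq_nonneg (a + c))]) hR2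
  -- (1) edge loss: √2·e^{−(a+c)²R²/(2α)} ≤ 1/2, via e^{−u} ≤ 1/(1+u) ≤ 1/3 for u ≥ 2 and √2 ≤ 3/2
  have hu : 2 ≤ (a + c) ^ 2 * R ^ 2 / (2 * α) := by
    rw [le_div_iff₀ (by positivity)]
    have := (div_le_iff₀ (by positivity : 0 < (a + c) ^ 2)).1 hT1
    nlinarith
  have hexp : Real.exp (-((a + c) ^ 2 * R ^ 2 / (2 * α))) ≤ 1 / 3 := by
    have h1 := Real.add_one_le_exp ((a + c) ^ 2 * R ^ 2 / (2 * α))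
    rw [Real.exp_neg, inv_eq_one_div, div_le_div_iff₀ (Real.exp_pos _) (by norm_num : (0:ℝ) < 3)]
    linarith
  have hsqrt2 : Real.sqrt 2 ≤ 3 / 2 := by
    rw [Real.sqrt_le_left (by norm_num)]; norm_num
  have hloss : 1 / 2 ≤ 1 - Real.sqrt 2 * Real.exp (-((a + c) ^ 2 * R ^ 2 / (2 * α))) := by
    have : Real.sqrt 2 * Real.exp (-((a + c) ^ 2 * R ^ 2 / (2 * α))) ≤ 3 / 2 * (1 / 3) :=
      mul_le_mul hsqrt2 hexp (Real.exp_pos _).le (by norm_num)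
    linarith
  -- (2) growth: Λ < ½·C·e^{κR²}
  have hgrow : Λ < 1 / 2 * (C * Real.exp (κ * R ^ 2)) := by
    have h1 : 1 + κ * R ^ 2 ≤ Real.exp (κ * R ^ 2) := by linarith [Real.add_one_le_exp (κ * R ^ 2)]
    have h2 : 2 * |Λ| / C + 1 ≤ κ * R ^ 2 := by
      have := (div_le_iff₀ hκ0).1 hT2; linarith
    have h3 : C * (2 * |Λ| / C + 1 + 1) ≤ C * Real.exp (κ * R ^ 2) := mul_le_mul_of_nonneg_left (by linarith) hC0.le
    have h4 : C * (2 * |Λ| / C + 1 + 1) = 2 * |Λ| + 2 * C := by field_simp; ring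
    linarith [le_abs_self Λ]
  -- assemble: Λ·f(R) < ½·C·e^{κR²}·f(R) ≤ (1 − loss)·(Kf)(R) ≤ (K Θf)(R)
  have hRmem : R ∈ {y : ℝ | |y| ≤ R} := by show |R| ≤ R; rw [abs_of_nonneg hR0]
  rw [Set.indicator_of_mem hRmem]
  have hratio : C * Real.exp (κ * R ^ 2) * Real.exp (-(c * R ^ 2)) = C * Real.exp (-((a + b - b ^ 2 / α) * R ^ 2)) := by
    rw [mul_assoc, ← Real.exp_add]; congr 2; rw [hκ]; field_simp; ring
  have hedge := truncated_action_edge_lower ha hb hc hR0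
  have hKf0 : 0 ≤ C * Real.exp (-((a + b - b ^ 2 / α) * R ^ 2)) := by positivity
  calc Λ * Real.exp (-(c * R ^ 2))
      < 1 / 2 * (C * Real.exp (κ * R ^ 2)) * Real.exp (-(c * R ^ 2)) := mul_lt_mul_of_pos_right hgrow (Real.exp_pos _)
    _ = 1 / 2 * (C * Real.exp (-((a + b - b ^ 2 / α) * R ^ 2))) := by rw [mul_assoc, hratio]
    _ ≤ (1 - Real.sqrt 2 * Real.exp (-((a + c) ^ 2 * R ^ 2 / (2 * α)))) * (C * Real.exp (-((a + b - b ^ 2 / α) * R ^ 2))) :=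
        mul_le_mul_of_nonneg_right hloss hKf0
    _ ≤ _ := hedge

/-! ## §4 TOO SOFT: the bound fails at the centre against the profile's own Rayleigh quotient -/

/-- ★★ **Under-stiff profiles fail against their own Rayleigh currency.**  For `0 < c` with `c² < a² + 2ab` (gap `−κ = (a²+2ab−c²)/(a+b+c) > 0`):
`⟨f_c, K f_c⟩ = √(π/(a+b+c))·√(π/(2c−κ))`, `⟨f_c,f_c⟩ = √(π/(2c))`, `(Kf_c)(0) = √(π/(a+b+c))`, and `(1+η)·RQ·f_c(0) < (K f_c)(0)` whenever
`(1+η)²·2c < 2c − κ` — a soft profile is not a quasimode for its self-Rayleigh currency with small `η`. [folklore] -/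
theorem selfRayleigh_fails_of_soft {a b c : ℝ} (hα : 0 < a + b + c) (hc : 0 < c) (hsoft : c ^ 2 < a ^ 2 + 2 * a * b) {η : ℝ}
    (hη0 : 0 ≤ 1 + η) (hη : (1 + η) ^ 2 * (2 * c) < 2 * c + (a ^ 2 + 2 * a * b - c ^ 2) / (a + b + c)) :
    (1 + η) * ((∫ x, Real.exp (-(c * x ^ 2)) *
          ∫ y, Real.exp (-(a * x ^ 2)) * Real.exp (-(b * (x - y) ^ 2)) * Real.exp (-(a * y ^ 2)) * Real.exp (-(c * y ^ 2))) /
        ∫ x, Real.exp (-(c * x ^ 2)) ^ 2) * Real.exp (-(c * (0:ℝ) ^ 2)) <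
      ∫ y, Real.exp (-(a * (0:ℝ) ^ 2)) * Real.exp (-(b * ((0:ℝ) - y) ^ 2)) * Real.exp (-(a * y ^ 2)) * Real.exp (-(c * y ^ 2)) := by
  set C := Real.sqrt (π / (a + b + c)) with hC
  have hC0 : 0 < C := Real.sqrt_pos.2 (div_pos Real.pi_pos hα)
  set ν := (a ^ 2 + 2 * a * b - c ^ 2) / (a + b + c) with hν
  have hν0 : 0 < ν := div_pos (by linarith) hα
  -- closed forms
  have hK : ∀ x : ℝ, ∫ y, Real.exp (-(a * x ^ 2)) * Real.exp (-(b * (x - y) ^ 2)) * Real.exp (-(a * y ^ 2)) * Real.exp (-(c * y ^ 2)) =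
      C * Real.exp (-(ν * x ^ 2)) * Real.exp (-(c * x ^ 2)) := by
    intro x; rw [mehler_gaussian_action_ratio hα]; congr 3; rw [hν]; field_simp; ring
  have hnum : ∫ x, Real.exp (-(c * x ^ 2)) * (C * Real.exp (-(ν * x ^ 2)) * Real.exp (-(c * x ^ 2))) = C * Real.sqrt (π / (2 * c + ν)) := by
    have h1 : ∀ x : ℝ, Real.exp (-(c * x ^ 2)) * (C * Real.exp (-(ν * x ^ 2)) * Real.exp (-(c * x ^ 2))) = C * Real.exp (-(2 * c + ν) * x ^ 2) := by
      intro x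
      have : Real.exp (-(c * x ^ 2)) * Real.exp (-(ν * x ^ 2)) * Real.exp (-(c * x ^ 2)) = Real.exp (-(2 * c + ν) * x ^ 2) := by
        rw [← Real.exp_add, ← Real.exp_add]; congr 1; ring
      rw [← this]; ring
    simp_rw [h1]
    rw [integral_const_mul, integral_gaussian]
  have hden : ∫ x, Real.exp (-(c * x ^ 2)) ^ 2 = Real.sqrt (π / (2 * c)) := by
    have h1 : ∀ x : ℝ, Real.exp (-(c * x ^ 2)) ^ 2 = Real.exp (-(2 * c) * x ^ 2) := by
      intro x; rw [sq, ← Real.exp_add]; congr 1; ring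
    simp_rw [h1]
    exact integral_gaussian (2 * c)
  simp_rw [hK]
  rw [hnum, hden]
  simp only [ne_eq, OfNat.ofNat_ne_zero, not_false_eq_true, zero_pow, mul_zero, neg_zero, Real.exp_zero, mul_one]
  -- goal: (1+η) * (C * √(π/(2c+ν)) / √(π/(2c))) < C
  have hs0 : 0 < Real.sqrt (π / (2 * c)) := Real.sqrt_pos.2 (by positivity)
  have hkey : (1 + η) * Real.sqrt (π / (2 * c + ν)) < Real.sqrt (π / (2 * c)) := by
    rw [Real.lt_sqrt (by positivity), mul_pow, Real.sq_sqrt (by positivity),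
      ← mul_div_assoc, div_lt_div_iff₀ (by positivity) (by positivity)]
    have hπ := Real.pi_pos
    nlinarith [mul_pos hπ hc, hη]
  have : (1 + η) * (C * Real.sqrt (π / (2 * c + ν)) / Real.sqrt (π / (2 * c))) =
      C * (((1 + η) * Real.sqrt (π / (2 * c + ν))) / Real.sqrt (π / (2 * c))) := by ring
  rw [this]
  calc C * (((1 + η) * Real.sqrt (π / (2 * c + ν))) / Real.sqrt (π / (2 * c))) < C * 1 := by
        refine mul_lt_mul_of_pos_left ?_ hC0
        rw [div_lt_one hs0]; exact hkey
    _ = C := mul_one C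

/-! ## §5 Consistency anchor with the tree's Mehler ratio -/

open Summit.QuantumFields.YangMills.Theorems.FemtoTransferGap.Mehler in
/-- ★ At the scaled lattice datum `(a, b) = (h/2, 1)` (`h ≥ 0` a stiff Hessian eigenvalue in units of `β`), the exact profile is `c_* = √(h²/4 + h)` and
lane A's β-free Mehler ratio is `r(h) = 1/(a + b + c_*)` — the top eigenvalue of §1 per unit free factor `√π`. [cite: Wipf2021, §8.5.1 (8.58)] -/
theorem mehlerRatio_eq_inv_denominator {h : ℝ} (hh : 0 ≤ h) :
    mehlerRatio h = 1 / (h / 2 + 1 + Real.sqrt ((h / 2) ^ 2 + 2 * (h / 2) * 1)) := by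
  unfold mehlerRatio
  have h4 : (h / 2) ^ 2 + 2 * (h / 2) * 1 = (h ^ 2 + 4 * h) / 4 := by ring
  rw [h4, Real.sqrt_div' _ (by norm_num : (0:ℝ) ≤ 4), show Real.sqrt 4 = 2 by rw [show (4:ℝ) = 2 ^ 2 by norm_num, Real.sqrt_sq (by norm_num)]]
  have hs : 0 ≤ Real.sqrt (h ^ 2 + 4 * h) := Real.sqrt_nonneg _
  field_simp

end Summit.QuantumFields.YangMills.Theorems.TwistedTraceScaling.Negative.R67

end
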